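import Literature.MathematicalPhysics.QuantumFieldTheory.GaussianFieldOfCovariance
import Literature.MathematicalPhysics.QuantumLattice.LatticeGaugeDLR
import Literature.MathematicalPhysics.QuantumLattice.LatticeScalarField
import Mathlib.Combinatorics.SimpleGraph.Metric
import HarnessLib

/-!
# Chatterjee's discrete Proca field: definition, covariance decay, convergence to the Euclidean Proca field

S. Chatterjee, *A scaling limit of `SU(2)` lattice Yang–Mills–Higgs theory*, Probab. Math. Phys.
**7** (2026) 339–381, arXiv:2401.10507 [Chatterjee2026YMHiggs], §4.3 (Definition 4.5, Theorem 4.6)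
and §4.6 (Lemma 4.10); theorem numbering of arXiv:2401.10507v4 (= the held corpus text; the
PMP pagination was not checked), as in the tree's `ContinuumLimits.chatterjee_su2_higgs`
(constructive-qft.S19, Thm 3.2 of the same paper) and `SU2HiggsKeyEstimate` (Lemma 5.5, proved).

This file TYPES (statements only; cross-ladder literature-typing layer, D-0088) the Gaussian
lattice field through which both main theorems of the paper (Thm 3.1 for `U(1)`, Thm 3.2 for
`SU(2)`) pass: in the proof of Thm 3.2 (§5.5) the unitary-gauge field `A` on a box
`Λ' = {−M, …, M}ᵈ`, `M ≍ ε⁻⁴`, is coupled in total variation (Lemmas 5.7–5.9) to three independent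
discrete Proca fields of mass parameter `α g/√2 = c ε/√2` (in the paper's normalisation), and the
continuum statement is then Theorem 4.6 below together with the boundary-insensitivity Lemma 4.11.

## Contents

* `procaEdges d L`, `procaPlaquettes d L`: the positively oriented edges and the plaquettes of the
  box `Λ_L = {−L, …, L}ᵈ ⊆ ℤᵈ` **without** identification of opposite faces (free boundary
  condition, §4.3: "Let `Λ`, `E` and `P` be as in Subsection 1.1, but now without identifying
  opposite faces"), in the tree's `ℤᵈ` vocabulary `ZdEdge d = Site d × Fin d`,
  `ZdPlaquette d` (`LatticeGaugeDLR`) and `box d L` (`ThermodynamicLimit`).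
* `latticeCurl x p = x(e₁) + x(e₂) − x(e₃) − x(e₄)`: the oriented plaquette sum `x(p)` of a real
  edge function (the display before Def. 4.5); `procaEnergy d L ε x = ½ ∑ₚ x(p)² + (ε²/2) ∑ₑ x(e)²`.
* `discreteProcaMeasure d L ε`: **Definition 4.5**, the centred Gaussian measure on real edge
  functions with density proportional to `exp (−procaEnergy)` with respect to Lebesgue measure on
  `ℝ^{E}`, realised on `ZdEdge d → ℝ` as the push-forward (extension by `0` off `procaEdges d L`,
  `extendEdges`) of the normalised density measure on `↥(procaEdges d L) → ℝ`.
* `procaEdgeGraph d L`: the graph on edges in which two edges are neighbours iff they share a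
  plaquette of `Λ_L` (§4.6), whose graph distance is the `d(e, e')` of Lemma 4.10.
* `discreteProca_covariance_decay` (**Lemma 4.10**, named fact):
  `|E(X(e) X(e'))| ≤ ε⁻² (1 − ε²/(16 d))^{d(e,e')}` for mass parameter `0 < ε ≤ 1`.
* `procaEdgeFieldLaw`, `discreteProca_tendstoInLaw` (**Theorem 4.6**, named fact): along
  `L → ∞`, `ε → 0` with `L ≥ ε^{−1−δ}`, the rescaled field `Y_i = ε^{−(d−2)/2} X(ε⁻¹·, i)`
  smeared against `φ dxᵢ` converges in law to the centred Gaussian of variance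
  `(φ dxᵢ, R₁ φ dxᵢ) = C₁(φ, φ) + C₁(∂ᵢφ, ∂ᵢφ)`, i.e. to the `eᵢ`-component of the Euclidean
  Proca field of parameter `λ = 1` (`procaComponentCovariance 1 (EuclideanSpace.single i 1)` of
  `GaussianFieldOfCovariance`, where that Gaussian field is proved to exist and to be unique).

## Rendering choices and deviations from print (all bookkeeping; listed again at each fact)

* One direction component at a time: the facts pair the field with the test 1-forms `φ dxᵢ`
  only, exactly as `chatterjee_su2_higgs` does (deviation (i) there); joint Gaussianity across
  directions (the off-diagonal covariances `λ⁻¹ ∫ (∂ᵢφᵢ) K_λ (∂ⱼφⱼ)`) is printed but not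
  transcribed — Schwartzian 1-forms `𝒜(ℝᵈ)` (§2.1) are not in the tree's vocabulary.
* Point sampling `φ(ε a)` (the tree's `finLatticeField`, `Φ = ρ εᵈ ∑ₐ φ(εa) X(a, i)`) instead of
  the Voronoi-cell averages `∫_{ε(D+a)} φ` of (4.?) — the vectors `u` and `w` of the printed proof
  of Thm 4.6, `‖u − w‖² = O(ε^{d+2})`, so the two smearings have the same limit in law (deviation
  (iii) at `chatterjee_su2_higgs`).
* Convergence in law of `Y(f)` for every `f` (§2.1) is rendered as `TendstoInLaw` (pointwise
  convergence of generating functionals); the two are equivalent (`t • φ ∈ 𝒮`).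
* Normalisation of `C_m`: `freeCovarianceReal m` is `⟨φ, (−Δ + m²)⁻¹ ψ⟩_{L²}` in Mathlib's Fourier
  convention (`FreeCovariance`, symbol `((2π‖ξ‖)² + m²)⁻¹`), i.e. the pairing with the heat-kernel
  integral `K_{m²}` of (2.1); so `(φ dxᵢ, R_λ φ dxᵢ) = ∫ φ K_λ φ + λ⁻¹ ∫ (∂ᵢφ) K_λ (∂ᵢφ)` (§4.5) is
  `procaComponentCovariance √λ eᵢ φ φ` (audit recorded in `ContinuumLimits`, module docstring
  "S19").

Not transcribed: Lemma 4.4 (Kolmogorov consistency: coordinatewise convergence in law gives a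
limit random distributional 1-form — in the tree the limit object is a measure on `𝒮'`, supplied by
`exists_procaComponentField`); Lemma 4.11 (insensitivity to boundary values prescribed on `∂E`,
`|E Y'(f) − E Y(f)| ≤ C L^{−B} ‖x‖`, `|Var Y'(f) − Var Y(f)| ≤ C L^{−B}` for `L ≥ ε⁻³`: conditioning
a Gaussian vector on a sub-family of coordinates has no vocabulary here); the eigenvalue bounds
`xᵀQx ≥ εᵈ‖x‖²`, `‖R‖ ≤ ε⁻ᵈ` inside the proof of Thm 4.6. No proofs (typing layer); the two results
are named facts `def … : Prop` (D-0014), both fully proved in the source (finite-dimensional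
Gaussian computations), hence dischargeable.
-/

noncomputable section

open scoped SchwartzMap ENNReal
open MeasureTheory Filter Topology Finset
open Literature.MathematicalPhysics.QuantumLattice
open Literature.Probability.LatticeModels (box)

namespace Literature.MathematicalPhysics.QuantumFieldTheory.Chatterjee2026YMHiggs

variable {d : ℕ}

/-! ### The box `Λ_L = {−L, …, L}ᵈ` with free boundary condition: edges and plaquettes -/

variable (d) in
/-- The positively oriented nearest-neighbour edges `(x, x + eᵢ)` of the box
`Λ_L = {−L, …, L}ᵈ ⊆ ℤᵈ` with BOTH endpoints in the box (no identification of opposite faces: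
free boundary condition), as elements `(x, i)` of `ZdEdge d`. This is Chatterjee's edge set `E`
of `Λ` "without identifying opposite faces" (§4.3, first paragraph; §1.1 for `E`).
[cite: Chatterjee2026YMHiggs, §4.3 (first paragraph) and §1.1 (the edge set E)] -/
def procaEdges (L : ℕ) : Finset (ZdEdge d) :=
  (box d L ×ˢ (univ : Finset (Fin d))).filter fun e => e.1 + Pi.single e.2 1 ∈ box d L

variable (d) in
/-- The plaquettes of the box `Λ_L = {−L, …, L}ᵈ` (free boundary condition): the unit squares
`(x; i < j)` of `ℤᵈ` all four of whose corners lie in `Λ_L`; since `Λ_L` is a product of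
intervals this is the condition `x ∈ Λ_L ∧ x + eᵢ + eⱼ ∈ Λ_L`. Chatterjee's plaquette set `P` of
`Λ` without identification of opposite faces (§4.3). [cite: Chatterjee2026YMHiggs, §4.3 (first paragraph) and §1.1 (plaquettes)] -/
def procaPlaquettes (L : ℕ) : Finset (ZdPlaquette d) :=
  (box d L ×ˢ (univ : Finset {p : Fin d × Fin d // p.1 < p.2})).filter
    fun p => p.1 + Pi.single p.2.1.1 1 + Pi.single p.2.1.2 1 ∈ box d L

/-- The oriented plaquette sum `x(p) := x(e₁) + x(e₂) − x(e₃) − x(e₄)` of a real edge function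
around the plaquette `p = (x; i < j)`, with `e₁ = (x, x + eᵢ)`, `e₂ = (x + eᵢ, x + eᵢ + eⱼ)`,
`e₃ = (x + eⱼ, x + eᵢ + eⱼ)`, `e₄ = (x, x + eⱼ)` (the lattice curl `dx(p)`; Chatterjee numbers the
edges so that `e₁` starts at the lexicographically smallest vertex, `e₂` is incident to its right
endpoint and `e₄` to its left endpoint — the overall sign is immaterial since only `x(p)²` is used).
[cite: Chatterjee2026YMHiggs, §4.3 (the display defining x(p) before Def. 4.5)] -/
def latticeCurl (x : ZdEdge d → ℝ) (p : ZdPlaquette d) : ℝ :=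
  x (p.1, p.2.1.1) + x (p.1 + Pi.single p.2.1.1 1, p.2.1.2) -
    x (p.1 + Pi.single p.2.1.2 1, p.2.1.1) - x (p.1, p.2.1.2)

variable (d) in
/-- The quadratic form in the exponent of the discrete Proca density with mass parameter `ε`:
`H(x) = ½ ∑_{p ∈ P} x(p)² + (ε²/2) ∑_{e ∈ E} x(e)²` over the plaquettes and edges of `Λ_L`.
[cite: Chatterjee2026YMHiggs, Def. 4.5] -/
def procaEnergy (L : ℕ) (ε : ℝ) (x : ZdEdge d → ℝ) : ℝ :=
  (1 / 2) * ∑ p ∈ procaPlaquettes d L, latticeCurl x p ^ 2 +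
    ε ^ 2 / 2 * ∑ e ∈ procaEdges d L, x e ^ 2

variable (d) in
/-- Extension by zero of a real function on the edges of `Λ_L` to all edges of `ℤᵈ` (the
discrete Proca field is indexed by `E`; off `E` the rescaled field of Thm 4.6 is `0` by the
printed convention "0 if not [an edge of `E`]"). [cite: Chatterjee2026YMHiggs, §4.3 (the display defining Y_i(w), second case)] -/
def extendEdges (L : ℕ) (y : procaEdges d L → ℝ) : ZdEdge d → ℝ :=
  fun e => if h : e ∈ procaEdges d L then y ⟨e, h⟩ else 0

/-! ### Definition 4.5: the discrete Proca field -/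

variable (d) in
/-- The un-normalised discrete Proca weight on `ℝ^{E}`, `E = procaEdges d L`:
`exp (−½ ∑ₚ x(p)² − (ε²/2) ∑ₑ x(e)²) dx` with respect to Lebesgue measure (`volume`, the product
of the Lebesgue measures of the coordinates). For `ε ≠ 0` its total mass is finite and positive
(the density is continuous, positive and `≤ exp (−ε²‖x‖²/2)`); not proved here.
[cite: Chatterjee2026YMHiggs, Def. 4.5] -/
def procaWeight (L : ℕ) (ε : ℝ) : Measure (procaEdges d L → ℝ) :=
  (volume : Measure (procaEdges d L → ℝ)).withDensity fun y =>
    ENNReal.ofReal (Real.exp (-procaEnergy d L ε (extendEdges d L y)))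

variable (d) in
/-- **Definition 4.5** (the discrete Proca field on `Λ_L = {−L, …, L}ᵈ` with mass parameter `ε`
and free boundary condition): "the Gaussian random vector `X = (X(e))_{e ∈ E}` with probability
density proportional to `exp (−½ ∑_{p ∈ P} x(p)² − (ε²/2) ∑_{e ∈ E} x(e)²)`" — here its law,
the normalised `procaWeight` pushed forward along extension by zero to real edge functions on
`ℤᵈ` (coordinates off `E` are a.s. `0`). Junk value (the zero measure) if the weight has mass `0`
or `∞`, which does not happen for `ε ≠ 0`. This is the lattice Maxwell (massless free) Gaussian
of the tree's `LatticeMaxwellGaussian` (Chatterjee 2016, axial gauge on cubes) with the gauge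
fixing replaced by the mass term `ε² ∑ x(e)²`, which alone makes the form positive definite
(`xᵀQx ≥ εᵈ‖x‖²` in the proof of Thm 4.6). [cite: Chatterjee2026YMHiggs, Def. 4.5] -/
def discreteProcaMeasure (L : ℕ) (ε : ℝ) : Measure (ZdEdge d → ℝ) :=
  ((procaWeight d L ε Set.univ)⁻¹ • procaWeight d L ε).map (extendEdges d L)

/-- Unfolding lemma for `discreteProcaMeasure`. [cite: Chatterjee2026YMHiggs, Def. 4.5] -/
theorem discreteProcaMeasure_eq (L : ℕ) (ε : ℝ) :
    discreteProcaMeasure d L ε =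
      ((procaWeight d L ε Set.univ)⁻¹ • procaWeight d L ε).map (extendEdges d L) := rfl

/-! ### Lemma 4.10: exponential decay of the covariance -/

variable (d) in
/-- The neighbour graph on edges used in §4.6: "Define a graph structure on `E` by declaring that
two edges are neighbors if they share a common plaquette" (of `Λ_L`, free boundary); its graph
distance is the `d(e, e')` of Lemma 4.10. Declared on all of `ZdEdge d` (edges outside `Λ_L`
are isolated) via `SimpleGraph.fromRel` (adjacent iff distinct and some plaquette of `Λ_L`
contains both). [cite: Chatterjee2026YMHiggs, §4.6 (first paragraph)] -/
def procaEdgeGraph (L : ℕ) : SimpleGraph (ZdEdge d) :=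
  SimpleGraph.fromRel fun e e' =>
    ∃ p ∈ procaPlaquettes d L, e ∈ plaquetteEdges p ∧ e' ∈ plaquetteEdges p

/-- **Lemma 4.10** (covariance decay of the discrete Proca field; named fact, D-0014 — proved in
the source by the Neumann series `R = (16 d ε^{d−2})⁻¹ ∑ₖ Sᵏ`, `S = I − (16 d ε^{d−2})⁻¹ Q`,
`‖S‖ ≤ 1 − ε²/(16 d)`, `Sᵏ(e, e') = 0` for `k < d(e, e')`). *Printed:* "Let `X` be a discrete
Proca field on `Λ = {−L, …, L}ᵈ` with mass parameter `ε ≤ 1`. Then for any `e, e' ∈ E`,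
`|E(X(e) X(e'))| ≤ ε⁻² (1 − (16 d)⁻¹ ε²)^{d(e,e')}`", `d(e, e')` the graph distance in the
plaquette-neighbour graph on `E` (§4.6). *Rendered:* for `2 ≤ d` (the paper's standing
`d ≥ 2`, §1.1/§2.2), `0 < ε ≤ 1` (Def. 4.5 has `ε > 0`), edges `e, e'` of `Λ_L`, and every
`k ≤ edist(e, e')` in `procaEdgeGraph d L` (so `k = d(e, e')` when `e, e'` are connected; for
edges in different components every `k`, giving covariance `0`, which the printed proof also
yields since then `Sᵏ(e, e') = 0` for all `k`): the covariance `∫ x(e) x(e') dX`, under the law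
`discreteProcaMeasure d L ε` (a centred Gaussian, so this is `E(X(e) X(e'))`), is at most
`ε⁻² (1 − ε²/(16 d))ᵏ` in absolute value. [cite: Chatterjee2026YMHiggs, Lemma 4.10 (§4.6); proof ibid.] -/
def discreteProca_covariance_decay : Prop :=
  ∀ (d L : ℕ) (ε : ℝ), 2 ≤ d → 0 < ε → ε ≤ 1 →
    ∀ e ∈ procaEdges d L, ∀ e' ∈ procaEdges d L, ∀ k : ℕ,
      (k : ℕ∞) ≤ (procaEdgeGraph d L).edist e e' →
        abs (∫ x, x e * x e' ∂(discreteProcaMeasure d L ε)) ≤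
          (ε ^ 2)⁻¹ * (1 - ε ^ 2 / (16 * d)) ^ k

/-! ### Theorem 4.6: convergence to the Euclidean Proca field -/

/-- The law of the rescaled, smeared `i`-th component of the discrete Proca field on `Λ_L` with
mass parameter `ε` at lattice spacing `ε`: Chatterjee's random 1-form
`Y_i(w) = ε^{−(d−2)/2} X(ε⁻¹ v, ε⁻¹ v + eᵢ)` (`w` in the Voronoi cell of `v ∈ εℤᵈ`; `0` if that is
not an edge of `E`) paired with the test 1-form `φ dxᵢ`, rendered with point sampling as the
tree's `finLatticeField (box d L) ε ε^{1−d/2} (a ↦ X(a, i))`,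
`Φ(φ) = ε^{1−d/2} εᵈ ∑_{a ∈ Λ_L} φ(ε a) X(a, i) = ε^{−(d−2)/2} ∑ₐ εᵈ φ(εa) X(a, i)` (the printed
`Y(φ dxᵢ) = ∑ₐ ε^{−(d−2)/2} X(a, i) ∫_{ε(D+a)} φ`, up to `‖u − w‖² = O(ε^{d+2})` as in the printed
proof), a measure on `FieldConfig ℝᵈ = 𝒮'(ℝᵈ)`. [cite: Chatterjee2026YMHiggs, §4.3 (the display defining Y from X before Thm 4.6)] -/
def procaEdgeFieldLaw (L : ℕ) (ε : ℝ) (i : Fin d) :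
    Measure (FieldConfig (EuclideanSpace ℝ (Fin d))) :=
  (discreteProcaMeasure d L ε).map fun x =>
    finLatticeField (box d L) ε (ε ^ (1 - (d : ℝ) / 2)) fun a => x (a, i)

/-- **Theorem 4.6** (the discrete Proca field converges to the Euclidean Proca field; named fact,
D-0014 — proved in the source). *Printed:* "Suppose that we take `L → ∞` and `ε → 0` along a
sequence satisfying `L ≥ ε^{−1−δ}` for some `δ > 0`. Then for any `f ∈ 𝒜(ℝᵈ)`, `Y(f)` converges in
law to a Gaussian random variable with mean zero and variance `(f, R₁ f)`, where `R₁` is the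
operator defined in equation (2.2) with `λ = 1`. Thus, the Euclidean Proca field exists for any
`λ > 0`, and `Y` converges in law to the Euclidean Proca field with `λ = 1`." Here `Y` is built
from the discrete Proca field on `Λ_L` with mass parameter `ε` (Def. 4.5) by
`Y_i(w) = ε^{−(d−2)/2} X(ε⁻¹v, ε⁻¹v + eᵢ)`. *Rendered:* for `2 ≤ d`, `δ > 0`, sequences `L : ℕ → ℕ`,
`ε : ℕ → ℝ` with `ε n > 0`, `ε n → 0` and `(ε n)^{−(1+δ)} ≤ L n` (hence `L n → ∞`), and each
direction `i`: the laws `procaEdgeFieldLaw (L n) (ε n) i` of `Y` paired with `φ dxᵢ` converge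
(`TendstoInLaw`: generating functionals, pointwise in `φ ∈ 𝒮(ℝᵈ)` — equivalent to convergence in
law of `Y(φ dxᵢ)` for every `φ`) to the `eᵢ`-component of the Euclidean Proca field of parameter
`λ = 1`: the centred Gaussian field `μ` on `𝒮'(ℝᵈ)` with
`∫ e^{iω(φ)} dμ = exp (−½ P_{1,eᵢ}(φ, φ))`, `P_{1,eᵢ}(φ, φ) = C₁(φ, φ) + C₁(∂ᵢφ, ∂ᵢφ)
= (φ dxᵢ, R₁ φ dxᵢ)` (`procaComponentCovariance 1 (EuclideanSpace.single i 1)`; §4.5 for the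
formula `(f, R_λ g) = ∑ᵢ ∫ fᵢ K_λ gᵢ + λ⁻¹ ∑ᵢⱼ ∫ (∂ᵢfᵢ) K_λ (∂ⱼgⱼ)`), which exists and is unique
(`exists_procaComponentField`, `procaComponentField_unique`). *Deviations* (bookkeeping inside the
printed proof, cf. `chatterjee_su2_higgs` (i), (iii)): one direction component at a time — joint
convergence across directions `i ≠ j` (off-diagonal Proca covariances) is printed, not
transcribed; point sampling `φ(εa)` for the Voronoi averages `∫_{ε(D+a)} φ`
(`‖u − w‖² = O(ε^{d+2})` in the printed proof). [cite: Chatterjee2026YMHiggs, Thm 4.6 (§4.3) with Def. 2.3 (2.4) and §4.5 (the covariance (f, R_λ f)); proof §4.3] -/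
def discreteProca_tendstoInLaw : Prop :=
  ∀ (d : ℕ), 2 ≤ d → ∀ (δ : ℝ), 0 < δ →
    ∀ (L : ℕ → ℕ) (ε : ℕ → ℝ), (∀ n, 0 < ε n) → Tendsto ε atTop (𝓝 0) →
      (∀ n, (ε n)⁻¹ ^ (1 + δ) ≤ (L n : ℝ)) →
      ∀ i : Fin d, ∃ μ : Measure (FieldConfig (EuclideanSpace ℝ (Fin d))),
        IsGaussianField μ ∧
        (∀ φ : 𝓢(EuclideanSpace ℝ (Fin d), ℝ), genFunctional μ φ =
          Complex.exp (-(1 / 2 : ℂ) *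
            (procaComponentCovariance 1 (EuclideanSpace.single i (1 : ℝ)) φ φ : ℂ))) ∧
        TendstoInLaw (fun n => procaEdgeFieldLaw (d := d) (L n) (ε n) i) atTop μ

end Literature.MathematicalPhysics.QuantumFieldTheory.Chatterjee2026YMHiggs
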